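import Literature.NumberTheory.EllipticCurves.KubertTateFiveMuDescentEisensteinMatrix
import Literature.NumberTheory.EllipticCurves.KubertTate1314EisensteinValuations
import Literature.NumberTheory.EllipticCurves.KubertTate1314Torsion
import Literature.NumberTheory.EllipticCurves.KubertTateFiveEisensteinTwist
import Mathlib.Tactic.NormNum.Prime
import HarnessLib

/-!
# The first `5`-descent over `ℚ(ζ₃)` with SPLIT primes: `E_{13/14} ⊗ ℚ(ζ₃)` has rank `4` and `Ш[5^∞] = 0`;
# the quadratic twist `E_{13/14}^{(-3)}/ℚ` — no rational `5`-torsion, `5` NON-anomalous — has RANK `2` and `t₅ = 0`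

PROOF-ONLY file (theorems only, no definition, no named fact, no `sorry`), topic `NumberTheory/EllipticCurves`;
an INSTANCE of the matrix form of the `5`-isogeny descent of the Kubert–Tate family over the Eisenstein field
(`KubertTateFiveMuDescentEisensteinMatrix.shaCorank_five_eq_zero_of_matrix_three`,
`mordellWeilRank_succ_eq_of_matrix_three`) at `(m, n) = (13, 14)`, on the tree's model `K3` of `ℚ(ζ₃)`:

  `E = E_{13/14} = [1, -182, -2548, 0, 0]`, `Δ = -2⁵·7⁵·13⁵·2029`, `rank E(ℚ) = 2`, `t₅(E) = 0`
  (tree `KubertTate1314RankLe`, `KubertTate1314ShaFive`); `mn = 2·7·13` with `7, 13 ≡ 1 (mod 3)` SPLIT in `ℤ[ζ₃]`.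

Over `K3 = ℚ(ζ₃)` the box has FIVE places `(2), (3 + ζ₃), (2 − ζ₃), (4 + ζ₃), (3 − ζ₃)`
(tree `KubertTate1314EisensteinDescent.exists_places`) and is filled by the three `ℚ`-points `−T = (0, 2548)`,
`P₁ = (-78, 936)`, `P₂ = (98, 392)` together with the two `ℚ(ζ₃)`-points `R₁ = (96 + 50ζ₃, 396 + 320ζ₃)`,
`R₂ = (120 − 40ζ₃, 700 + 200ζ₃)` (found by a sieved search over `ℤ[ζ₃]`; the anti-invariant parts `R_i − R̄_i` are the
points `u = -637/3`, `-19747/243` of the twist `-3Y² = g(u)`, invisible to a naive search in `u = p/q²`): the `5 × 5` matrix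
of orders of the Kummer values `f_T = xy − 14x² + 196y` relative to `f_T(2T) = 430612` (valuation table
`log_valuation_points/base`),

  `M = [[3, 3, 3, 2, 2], [4, 2, 2, 2, 2], [4, 3, 3, 3, 3], [4, 2, 4, 0, 3], [3, 2, 2, 3, 2]]` (mod `5`, `log`-normalised),

is invertible mod `5` (inverse `[[0, 2, 2, 0, 0], [3, 4, 1, 2, 1], [3, 2, 1, 3, 4], [0, 1, 2, 0, 1], [4, 2, 2, 0, 4]]`): the `ℚ(ζ₃)`-rows differ at the conjugate places, which no `ℚ`-point can do.
Hence, with NO `L`-function, `p`-adic or conjectural input: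

* `shaCorank_five_eq_zero` — **`t₅(E_{13/14} ⊗ ℚ(ζ₃)) = 0`**; `sha_torsionBy_five_eq_bot` — `Ш(E ⊗ ℚ(ζ₃))[5] = 0`;
* `mordellWeilRank_eq_four` — **`rank E_{13/14}(ℚ(ζ₃)) = 4`** (`#E(ℚ(ζ₃))[5] = 5`: no `ζ₅` in `ℚ(ζ₃)`);
* sequel `KubertTate1314EisensteinTwist`: `rank E_{13/14}^{(-3)}(ℚ) = 4 − 2 = 2` and `t₅(E_{13/14}^{(-3)}/ℚ) = 0` — a RANK-TWO
  curve over `ℚ` without rational `5`-torsion at which `5` is a good ordinary NON-ANOMALOUS Eisenstein prime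
  (`a₅ = -a₅(E) = 4`), `t₅ = 0` by descent alone: the first rank-`2` door of the route's Eisenstein-twist instrument
  (transfer statement T, stmt-22356; the tree's Gaussian rank-`2` door `KubertTate14613GaussianDescent` is anomalous
  at `5`).  No `p`-converse theorem is in print at rank `2`: nothing here proves T or BSD.

## References

* [SilvermanAEC2009] J. H. Silverman, *AEC*, 2nd ed., Thm. X.4.2, Prop. X.4.9, Exercise 10.1(c), Exercise 10.16,
  VII.3.1(b).
* [Fisher2001FiveSevenDescent] T. Fisher, JEMS 3 (2001), §§1–2.
* [IrelandRosen1982] K. Ireland, M. Rosen, *A Classical Introduction to Modern Number Theory*, Ch. 9 §1 Prop. 9.1.4.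
* [Dokchitser2013ParityNotes] T. Dokchitser, Notes on the parity conjecture (2013), §4.
-/

noncomputable section

open scoped Classical NNReal NumberField AddSubgroup
open WeierstrassCurve WeierstrassCurve.Isogeny Field IsDedekindDomain Ideal
open Literature.NumberTheory.EllipticCurves Literature.NumberTheory.EllipticCurves.KubertTateVelu
  Literature.NumberTheory.EllipticCurves.KubertTateMuDescentNF Literature.NumberTheory.NumberFields
  Literature.NumberTheory.NumberFields.K3

namespace Literature.NumberTheory.EllipticCurves

namespace KubertTate1314EisensteinDescent

/-! ## §1 The curve over `ℚ` in the family's integer coordinates, and the points over `ℚ(ζ₃)` -/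

/-- `E_{13/14}` in the family's cast coordinates is the tree's `KubertTate1314Descent.E`. [cite: Kubert1976, Table 3 (N = 5)] -/
theorem curve_eq_E : kubertTateFive (((13 : ℤ) : ℚ)) (((14 : ℤ) : ℚ)) = KubertTate1314Descent.E := by
  rw [Int.cast_ofNat, Int.cast_ofNat]

/-- `E_{13/14}` is elliptic (tree `KubertTate1314Torsion`, cast coordinates). [cite: Kubert1976, Table 3 (N = 5)] -/
theorem isElliptic_rat : (kubertTateFive (((13 : ℤ) : ℚ)) (((14 : ℤ) : ℚ))).IsElliptic := by
  rw [curve_eq_E]; infer_instance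

/-- `Δ(E_{13/14}) = -405171591170528 = -2⁵·7⁵·13⁵·2029` (integer model). [cite: Kubert1976, Table 3 (N = 5)] -/
theorem Δ_int : (kubertTateFive (13 : ℤ) 14).Δ = -405171591170528 := by
  rw [kubertTateFive_Δ]; norm_num

/-- `5 ∤ Δ`: good reduction at `5`. [cite: Fisher2001FiveSevenDescent, §2] -/
theorem not_five_dvd_Δ : ¬ (5 : ℤ) ∣ (kubertTateFive (13 : ℤ) 14).Δ := by
  rw [Δ_int]; norm_num

/-- `3 ∤ Δ`: good reduction at `3` (used for the rational torsion bound `25 P₁ ≠ O`). [cite: SilvermanAEC2009, VII.3.1(b)] -/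
theorem not_tor_dvd_Δ : ¬ ((3 : ℕ) : ℤ) ∣ (kubertTateFive (13 : ℤ) 14).Δ := by
  rw [Δ_int]; norm_num

/-- **EISENSTEIN-TAME**: every bad prime `ℓ ∈ {2, 7, 13, 2029}` has `ℓ ≢ 1 (mod 5)`, and `ℓ ≡ 4 (mod 5) ⇒ ℓ ≡ 1 (mod 3)`
(`2029 ≡ 4 (mod 5)`, `2029 ≡ 1 (mod 3)`). [cite: Fisher2001FiveSevenDescent, §2] -/
theorem eisenstein_tame : ∀ p : ℕ, p.Prime → (p : ℤ) ∣ (kubertTateFive (13 : ℤ) 14).Δ →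
    p % 5 ≠ 1 ∧ (p % 5 = 4 → p % 3 = 1) := by
  intro p hp hdvd
  rw [Δ_int] at hdvd
  have hdvdN : p ∣ 2 ^ 5 * 7 ^ 5 * 13 ^ 5 * 2029 := by
    have h' : (p : ℤ) ∣ ((2 ^ 5 * 7 ^ 5 * 13 ^ 5 * 2029 : ℕ) : ℤ) := by
      have e : ((2 ^ 5 * 7 ^ 5 * 13 ^ 5 * 2029 : ℕ) : ℤ) = 405171591170528 := by norm_num
      rw [e]; exact (Int.dvd_neg.mpr hdvd)
    exact Int.natCast_dvd_natCast.mp h'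
  have hpi := Nat.Prime.prime hp
  rcases hpi.dvd_or_dvd hdvdN with h | h
  · rcases hpi.dvd_or_dvd h with h | h
    · rcases hpi.dvd_or_dvd h with h | h
      · have := (Nat.prime_dvd_prime_iff_eq hp Nat.prime_two).mp (hpi.dvd_of_dvd_pow h); omega
      · have := (Nat.prime_dvd_prime_iff_eq hp (by norm_num : Nat.Prime 7)).mp (hpi.dvd_of_dvd_pow h); omega
    · have := (Nat.prime_dvd_prime_iff_eq hp (by norm_num : Nat.Prime 13)).mp (hpi.dvd_of_dvd_pow h); omega
  · have := (Nat.prime_dvd_prime_iff_eq hp (by norm_num : Nat.Prime 2029)).mp h; omega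

/-- `E_{13/14} ⊗ K3` is elliptic. [cite: Kubert1976, Table 3 (N = 5)] -/
theorem isElliptic : (kubertTateFive ((13 : ℤ) : K3) ((14 : ℤ) : K3)).IsElliptic :=
  haveI := isElliptic_rat
  KubertTateGaussianTwist.isElliptic_base (K := K3) 13 14

/-- `ζ₃² + ζ₃ + 1 = 0` on the model `K3`. [folklore] -/
private theorem hsq : (zeta : K3) ^ 2 + zeta + 1 = 0 := by
  rw [zeta_sq]; ring

/-- The three `ℚ`-points `−T = (0, 2548)`, `P₁ = (-78, 936)`, `P₂ = (98, 392)`, the two `ℚ(ζ₃)`-points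
`R₁ = (96 + 50ζ₃, 396 + 320ζ₃)`, `R₂ = (120 − 40ζ₃, 700 + 200ζ₃)` and the base point `2T = (182, 2366)` lie on `E_{13/14} ⊗ K3`.
[cite: Fisher2001FiveSevenDescent, §2 (the family; these points verified in-file)] -/
theorem nonsingular_points :
    (kubertTateFive ((13 : ℤ) : K3) ((14 : ℤ) : K3)).toAffine.Nonsingular 0 2548 ∧
    (kubertTateFive ((13 : ℤ) : K3) ((14 : ℤ) : K3)).toAffine.Nonsingular (-78) 936 ∧
    (kubertTateFive ((13 : ℤ) : K3) ((14 : ℤ) : K3)).toAffine.Nonsingular 98 392 ∧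
    (kubertTateFive ((13 : ℤ) : K3) ((14 : ℤ) : K3)).toAffine.Nonsingular ((96 : K3) + 50 * zeta) ((396 : K3) + 320 * zeta) ∧
    (kubertTateFive ((13 : ℤ) : K3) ((14 : ℤ) : K3)).toAffine.Nonsingular ((120 : K3) - 40 * zeta) ((700 : K3) + 200 * zeta) ∧
    (kubertTateFive ((13 : ℤ) : K3) ((14 : ℤ) : K3)).toAffine.Nonsingular 182 2366 := by
  haveI := isElliptic
  refine ⟨?_, ?_, ?_, ?_, ?_, ?_⟩ <;>
    rw [← Affine.equation_iff_nonsingular, KubertTateMuDescentNF.equation_iff_base (K := K3) 13 14] <;> push_cast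
  · norm_num
  · norm_num
  · norm_num
  · linear_combination ((-21600 : K3) - 125000 * zeta) * hsq
  · linear_combination ((-316800 : K3) + 64000 * zeta) * hsq
  · norm_num

/-- `P₁ = (-78, 936) ∈ E(ℚ)` (reference point of the `μ₅`-side). [cite: SilvermanAEC2009, VIII.§1] -/
theorem nonsingular_P₁_rat :
    (kubertTateFive (((13 : ℤ) : ℚ)) (((14 : ℤ) : ℚ))).toAffine.Nonsingular (-78) 936 := by
  rw [curve_eq_E]; exact (KubertTate1314Descent.nonsingular_iff _ _).mpr (by norm_num)

/-! ## §2 Two places over different rational primes, or conjugate places, are distinct -/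

/-- Places above different rational primes are different. [cite: IrelandRosen1982, Ch. 9 §1] -/
private theorem ne_of_natCast_mem {v w : HeightOneSpectrum (𝓞 K3)} {ℓ ℓ' : ℕ} (hℓ : ℓ.Prime) (hℓ' : ℓ'.Prime)
    (hne : ℓ ≠ ℓ') (h : (ℓ : 𝓞 K3) ∈ v.asIdeal) (h' : (ℓ' : 𝓞 K3) ∈ w.asIdeal) : v ≠ w := by
  rintro rfl
  have hd := natCast_dvd_of_intCast_mem hℓ h (d := ℓ') (by rw [Int.cast_natCast]; exact h')
  exact hne ((Nat.prime_dvd_prime_iff_eq hℓ hℓ').mp (Int.natCast_dvd_natCast.mp hd))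

/-! ## §3 The descent over `ℚ(ζ₃)`: box full at five places -/

/-- **The complete `5`-descent of `E_{13/14}` over `ℚ(ζ₃)`**: `t₅(E ⊗ ℚ(ζ₃)) = 0`, `Ш(E ⊗ ℚ(ζ₃))[5] = 0` and
`rank E(ℚ(ζ₃)) + 1 = 5` (box of five places filled by three `ℚ`-points and two `ℚ(ζ₃)`-points; matrix invertible mod `5`).
[cite: SilvermanAEC2009, Thm. X.4.2(a) and Thm. X.1.1] [cite: Fisher2001FiveSevenDescent, §2] -/
theorem descent :
    haveI := isElliptic
    (kubertTateFive ((13 : ℤ) : K3) ((14 : ℤ) : K3)).shaCorank 5 = 0 ∧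
      (kubertTateFive ((13 : ℤ) : K3) ((14 : ℤ) : K3)).sha[((5 : ℕ) : ℤ)] = ⊥ ∧
      (kubertTateFive ((13 : ℤ) : K3) ((14 : ℤ) : K3)).mordellWeilRank + 1 = 5 := by
  haveI := isElliptic
  haveI := isElliptic_rat
  haveI : Fact (Nat.Prime 3) := ⟨Nat.prime_three⟩
  obtain ⟨v₀, v₁, v₂, v₃, v₄, hv₀, hv₁, hv₂, hv₃, hv₄⟩ := exists_places
  obtain ⟨hℓ₀, hℓ₁, hℓ₂, hℓ₃, hℓ₄⟩ := natCast_mem_places hv₀ hv₁ hv₂ hv₃ hv₄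
  have hπ₀ : (2 : 𝓞 K3) ∈ v₀.asIdeal := by rw [hv₀]; exact mem_span_singleton_self _
  have hπ₁ : mkInt 3 1 ∈ v₁.asIdeal := by rw [hv₁]; exact mem_span_singleton_self _
  have hπ₂ : mkInt 2 (-1) ∈ v₂.asIdeal := by rw [hv₂]; exact mem_span_singleton_self _
  have hπ₃ : mkInt 4 1 ∈ v₃.asIdeal := by rw [hv₃]; exact mem_span_singleton_self _
  have hπ₄ : mkInt 3 (-1) ∈ v₄.asIdeal := by rw [hv₄]; exact mem_span_singleton_self _
  have p₀ : Prime (2 : 𝓞 K3) := prime_two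
  have p₁ : Prime (mkInt 3 1) := prime_mkInt_of_norm_eq_prime (p := 7) (by norm_num) (by norm_num)
  have p₂ : Prime (mkInt 2 (-1)) := prime_mkInt_of_norm_eq_prime (p := 7) (by norm_num) (by norm_num)
  have p₃ : Prime (mkInt 4 1) := prime_mkInt_of_norm_eq_prime (p := 13) (by norm_num) (by norm_num)
  have p₄ : Prime (mkInt 3 (-1)) := prime_mkInt_of_norm_eq_prime (p := 13) (by norm_num) (by norm_num)
  -- distinctness of the five places
  have h01 : v₀ ≠ v₁ := ne_of_natCast_mem Nat.prime_two (by norm_num) (by norm_num) hℓ₀ hℓ₁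
  have h02 : v₀ ≠ v₂ := ne_of_natCast_mem Nat.prime_two (by norm_num) (by norm_num) hℓ₀ hℓ₂
  have h03 : v₀ ≠ v₃ := ne_of_natCast_mem Nat.prime_two (by norm_num) (by norm_num) hℓ₀ hℓ₃
  have h04 : v₀ ≠ v₄ := ne_of_natCast_mem Nat.prime_two (by norm_num) (by norm_num) hℓ₀ hℓ₄
  have h13 : v₁ ≠ v₃ := ne_of_natCast_mem (by norm_num) (by norm_num) (by norm_num) hℓ₁ hℓ₃
  have h14 : v₁ ≠ v₄ := ne_of_natCast_mem (by norm_num) (by norm_num) (by norm_num) hℓ₁ hℓ₄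
  have h23 : v₂ ≠ v₃ := ne_of_natCast_mem (by norm_num) (by norm_num) (by norm_num) hℓ₂ hℓ₃
  have h24 : v₂ ≠ v₄ := ne_of_natCast_mem (by norm_num) (by norm_num) (by norm_num) hℓ₂ hℓ₄
  have h12 : v₁ ≠ v₂ := by
    intro e
    have hne := span_ne_span_conj (a := 3) (b := 1) (p := 7) (by norm_num) (by norm_num) (by norm_num)
    have e' : (3 : ℤ) - 1 = 2 := by norm_num
    rw [e'] at hne
    exact hne (by rw [← hv₁, ← hv₂, e])
  have h34 : v₃ ≠ v₄ := by
    intro e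
    have hne := span_ne_span_conj (a := 4) (b := 1) (p := 13) (by norm_num) (by norm_num) (by norm_num)
    have e' : (4 : ℤ) - 1 = 3 := by norm_num
    rw [e'] at hne
    exact hne (by rw [← hv₃, ← hv₄, e])
  have hpl : Function.Injective ![v₀, v₁, v₂, v₃, v₄] := by
    intro i j h
    fin_cases i <;> fin_cases j
    · rfl
    · exact absurd h h01
    · exact absurd h h02
    · exact absurd h h03
    · exact absurd h h04
    · exact absurd h h01.symm
    · rfl
    · exact absurd h h12
    · exact absurd h h13
    · exact absurd h h14
    · exact absurd h h02.symm
    · exact absurd h h12.symm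
    · rfl
    · exact absurd h h23
    · exact absurd h h24
    · exact absurd h h03.symm
    · exact absurd h h13.symm
    · exact absurd h h23.symm
    · rfl
    · exact absurd h h34
    · exact absurd h h04.symm
    · exact absurd h h14.symm
    · exact absurd h h24.symm
    · exact absurd h h34.symm
    · rfl
  -- the support: off the five places, `13` and `14 = 2·7` are units
  have hS : ∀ v : HeightOneSpectrum (𝓞 K3), (∀ j, ![v₀, v₁, v₂, v₃, v₄] j ≠ v) →
      (((13 : ℤ) : ℤ) : 𝓞 K3) ∉ v.asIdeal ∧ (((14 : ℤ) : ℤ) : 𝓞 K3) ∉ v.asIdeal := by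
    intro v hv
    have n0 : v₀ ≠ v := hv 0
    have n1 : v₁ ≠ v := hv 1
    have n2 : v₂ ≠ v := hv 2
    have n3 : v₃ ≠ v := hv 3
    have n4 : v₄ ≠ v := hv 4
    have hP := v.isPrime
    constructor
    · intro h13mem
      have e : (((13 : ℤ) : ℤ) : 𝓞 K3) = mkInt 4 1 * mkInt 3 (-1) := by
        rw [mkInt_mul, ← mkInt_intCast, mkInt_inj]; norm_num
      rw [e] at h13mem
      rcases hP.mem_or_mem h13mem with h | h
      · exact n3 (eq_of_mem_of_mem_of_prime p₃ hπ₃ h)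
      · exact n4 (eq_of_mem_of_mem_of_prime p₄ hπ₄ h)
    · intro h14mem
      have e : (((14 : ℤ) : ℤ) : 𝓞 K3) = 2 * (mkInt 3 1 * mkInt 2 (-1)) := by
        rw [mkInt_mul, show (2 : 𝓞 K3) = mkInt 2 0 by rw [mkInt_intCast]; norm_num, mkInt_mul, ← mkInt_intCast,
          mkInt_inj]; norm_num
      rw [e] at h14mem
      rcases hP.mem_or_mem h14mem with h | h
      · exact n0 (eq_of_mem_of_mem_of_prime p₀ hπ₀ h)
      · rcases hP.mem_or_mem h with h | h
        · exact n1 (eq_of_mem_of_mem_of_prime p₁ hπ₁ h)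
        · exact n2 (eq_of_mem_of_mem_of_prime p₂ hπ₂ h)
  -- the points; the two `ℚ(ζ₃)`-points have non-rational (in particular nonzero) abscissae
  obtain ⟨hn0, hn1, hn2, hn3, hn4, hnb⟩ := nonsingular_points
  have hx3 : (96 : K3) + 50 * zeta ≠ 0 := fun h ↦ by
    have h' : (6916 : K3) = 0 := by linear_combination ((46 : K3) - 50 * zeta) * h + (2500 : K3) * hsq
    norm_num at h'
  have hx4 : (120 : K3) - 40 * zeta ≠ 0 := fun h ↦ by
    have h' : (20800 : K3) = 0 := by linear_combination ((160 : K3) + 40 * zeta) * h + (1600 : K3) * hsq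
    norm_num at h'
  have hxy : ∀ i : Fin 5, ¬ (![(0 : K3), -78, 98, (96 : K3) + 50 * zeta, (120 : K3) - 40 * zeta] i = 0 ∧ ![(2548 : K3), 936, 392, (396 : K3) + 320 * zeta, (700 : K3) + 200 * zeta] i = 0) := by
    intro i
    fin_cases i
    · simp only [Fin.zero_eta, Matrix.cons_val_zero]; norm_num
    · simp only [Fin.mk_one, Matrix.cons_val_one, Matrix.cons_val_zero]; norm_num
    · simp only [Fin.reduceFinMk, Matrix.cons_val]; norm_num
    · simp only [Fin.reduceFinMk, Matrix.cons_val]; exact fun h ↦ hx3 h.1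
    · simp only [Fin.reduceFinMk, Matrix.cons_val]; exact fun h ↦ hx4 h.1
  -- the Kummer values as elements of `ℤ[ζ₃]`
  have hf : ∀ i : Fin 5, (![(0 : K3), -78, 98, (96 : K3) + 50 * zeta, (120 : K3) - 40 * zeta] i) * (![(2548 : K3), 936, 392, (396 : K3) + 320 * zeta, (700 : K3) + 200 * zeta] i) - ((14 : ℤ) : K3) * (![(0 : K3), -78, 98, (96 : K3) + 50 * zeta, (120 : K3) - 40 * zeta] i) ^ 2 +
      ((14 : ℤ) : K3) ^ 2 * (![(2548 : K3), 936, 392, (396 : K3) + 320 * zeta, (700 : K3) + 200 * zeta] i) =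
      ((![(mkInt 499408 0 : 𝓞 K3), (mkInt 25272 0 : 𝓞 K3), (mkInt (-19208) 0 : 𝓞 K3), (mkInt 5608 (-2160) : 𝓞 K3), (mkInt 50000 200000 : 𝓞 K3)] i : 𝓞 K3) : K3) := by
    intro i
    fin_cases i
    · simp only [Fin.zero_eta, Matrix.cons_val_zero, coe_mkInt, mk_eq]
      push_cast; ring
    · simp only [Fin.mk_one, Matrix.cons_val_one, Matrix.cons_val_zero, coe_mkInt, mk_eq]
      push_cast; ring
    · simp only [Fin.reduceFinMk, Matrix.cons_val, coe_mkInt, mk_eq]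
      push_cast; ring
    · simp only [Fin.reduceFinMk, Matrix.cons_val, coe_mkInt, mk_eq]
      push_cast
      linear_combination (-19000 : K3) * hsq
    · simp only [Fin.reduceFinMk, Matrix.cons_val, coe_mkInt, mk_eq]
      push_cast
      linear_combination (-30400 : K3) * hsq
  have hfb : (182 : K3) * 2366 - ((14 : ℤ) : K3) * 182 ^ 2 + ((14 : ℤ) : K3) ^ 2 * 2366 =
      (((mkInt 430612 0 : 𝓞 K3) : 𝓞 K3) : K3) := by
    rw [coe_mkInt, mk_eq]; push_cast; ring
  -- the matrix and its inverse mod 5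
  have hmat : Matrix.of (fun i j : Fin 5 ↦
      ((WithZero.log ((![v₀, v₁, v₂, v₃, v₄] j).valuation K3
          ((![(0 : K3), -78, 98, (96 : K3) + 50 * zeta, (120 : K3) - 40 * zeta] i) * (![(2548 : K3), 936, 392, (396 : K3) + 320 * zeta, (700 : K3) + 200 * zeta] i) -
            ((14 : ℤ) : K3) * (![(0 : K3), -78, 98, (96 : K3) + 50 * zeta, (120 : K3) - 40 * zeta] i) ^ 2 +
            ((14 : ℤ) : K3) ^ 2 * (![(2548 : K3), 936, 392, (396 : K3) + 320 * zeta, (700 : K3) + 200 * zeta] i))) -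
        WithZero.log ((![v₀, v₁, v₂, v₃, v₄] j).valuation K3
          ((182 : K3) * 2366 - ((14 : ℤ) : K3) * 182 ^ 2 + ((14 : ℤ) : K3) ^ 2 * 2366)) : ℤ) : ZMod 5)) =
      !![3, 3, 3, 2, 2; 4, 2, 2, 2, 2; 4, 3, 3, 3, 3; 4, 2, 4, 0, 3; 3, 2, 2, 3, 2] := by
    ext i j
    simp only [Matrix.of_apply]
    rw [hf i, hfb, log_valuation_points hv₀ hv₁ hv₂ hv₃ hv₄ i j, log_valuation_base hv₀ hv₁ hv₂ hv₃ hv₄ j]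
    fin_cases i <;> fin_cases j <;> decide
  have hinv : (!![0, 2, 2, 0, 0; 3, 4, 1, 2, 1; 3, 2, 1, 3, 4; 0, 1, 2, 0, 1; 4, 2, 2, 0, 4] : Matrix (Fin 5) (Fin 5) (ZMod 5)) *
      !![3, 3, 3, 2, 2; 4, 2, 2, 2, 2; 4, 3, 3, 3, 3; 4, 2, 4, 0, 3; 3, 2, 2, 3, 2] = 1 := by decide
  have hM : ∀ e : Fin 5 → ZMod 5, ∃ c : Fin 5 → ZMod 5, Matrix.vecMul c (Matrix.of (fun i j : Fin 5 ↦
      ((WithZero.log ((![v₀, v₁, v₂, v₃, v₄] j).valuation K3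
          ((![(0 : K3), -78, 98, (96 : K3) + 50 * zeta, (120 : K3) - 40 * zeta] i) * (![(2548 : K3), 936, 392, (396 : K3) + 320 * zeta, (700 : K3) + 200 * zeta] i) -
            ((14 : ℤ) : K3) * (![(0 : K3), -78, 98, (96 : K3) + 50 * zeta, (120 : K3) - 40 * zeta] i) ^ 2 +
            ((14 : ℤ) : K3) ^ 2 * (![(2548 : K3), 936, 392, (396 : K3) + 320 * zeta, (700 : K3) + 200 * zeta] i))) -
        WithZero.log ((![v₀, v₁, v₂, v₃, v₄] j).valuation K3
          ((182 : K3) * 2366 - ((14 : ℤ) : K3) * 182 ^ 2 + ((14 : ℤ) : K3) ^ 2 * 2366)) : ℤ) : ZMod 5))) = e := by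
    intro e
    refine ⟨Matrix.vecMul e !![0, 2, 2, 0, 0; 3, 4, 1, 2, 1; 3, 2, 1, 3, 4; 0, 1, 2, 0, 1; 4, 2, 2, 0, 4], ?_⟩
    rw [hmat, Matrix.vecMul_vecMul, hinv, Matrix.vecMul_one]
  -- the reference point `P₁ = (-78, 936)`, `25 P₁ ≠ O` transported from `ℚ` (good prime `3`)
  have h25 := KubertTateGaussianTwist.twentyfive_zsmul_toGeomPoints_cast_ne_zero (K := K3) 13 14 nonsingular_P₁_rat
    (by norm_num) (by norm_num) 3 (by norm_num) (by norm_num) not_tor_dvd_Δ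
  refine ⟨?_, ?_, ?_⟩
  · exact KubertTateMuDescentNF.shaCorank_five_eq_zero_of_matrix_three 13 14 _ (fun σ ↦ smul_toGeomPoints _ σ _) h25
      not_five_dvd_Δ eisenstein_tame ![v₀, v₁, v₂, v₃, v₄] hpl hS
      ![(0 : K3), -78, 98, (96 : K3) + 50 * zeta, (120 : K3) - 40 * zeta]
      ![(2548 : K3), 936, 392, (396 : K3) + 320 * zeta, (700 : K3) + 200 * zeta]
      (fun i ↦ by fin_cases i <;> assumption) hxy
      182 2366 hnb (by norm_num) hM
  · exact KubertTateMuDescentNF.sha_torsionBy_five_eq_bot_of_matrix_three 13 14 _ (fun σ ↦ smul_toGeomPoints _ σ _) h25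
      not_five_dvd_Δ eisenstein_tame ![v₀, v₁, v₂, v₃, v₄] hpl hS
      ![(0 : K3), -78, 98, (96 : K3) + 50 * zeta, (120 : K3) - 40 * zeta]
      ![(2548 : K3), 936, 392, (396 : K3) + 320 * zeta, (700 : K3) + 200 * zeta]
      (fun i ↦ by fin_cases i <;> assumption) hxy
      182 2366 hnb (by norm_num) hM
  · exact KubertTateMuDescentNF.mordellWeilRank_succ_eq_of_matrix_three 13 14 _ (fun σ ↦ smul_toGeomPoints _ σ _) h25
      not_five_dvd_Δ eisenstein_tame ![v₀, v₁, v₂, v₃, v₄] hpl hS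
      ![(0 : K3), -78, 98, (96 : K3) + 50 * zeta, (120 : K3) - 40 * zeta]
      ![(2548 : K3), 936, 392, (396 : K3) + 320 * zeta, (700 : K3) + 200 * zeta]
      (fun i ↦ by fin_cases i <;> assumption) hxy
      182 2366 hnb (by norm_num) hM

/-! ## §4 The theorems -/

/-- **`t₅(E_{13/14} ⊗ ℚ(ζ₃)) = corank_{ℤ₅} Ш(E_{13/14}/ℚ(ζ₃))[5^∞] = 0`, UNCONDITIONALLY**, by the complete `5`-descent over
`ℚ(ζ₃)` at five places (two of them pairs of conjugate split primes). [cite: SilvermanAEC2009, Thm. X.4.2(a)]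
[cite: Fisher2001FiveSevenDescent, §2] -/
theorem shaCorank_five_eq_zero :
    haveI := isElliptic
    (kubertTateFive ((13 : ℤ) : K3) ((14 : ℤ) : K3)).shaCorank 5 = 0 := descent.1

/-- **`Ш(E_{13/14}/ℚ(ζ₃))[5] = 0`, unconditionally.** [cite: SilvermanAEC2009, Thm. X.4.2(a)] -/
theorem sha_torsionBy_five_eq_bot :
    haveI := isElliptic
    (kubertTateFive ((13 : ℤ) : K3) ((14 : ℤ) : K3)).sha[((5 : ℕ) : ℤ)] = ⊥ := descent.2.1

/-- **`rank E_{13/14}(ℚ(ζ₃)) = 4`, unconditionally** (the descent over `ℚ(ζ₃)` computes the rank: box of five places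
full, `#E(ℚ(ζ₃))[5] = 5`). [cite: SilvermanAEC2009, Thm. X.4.2 and Thm. X.1.1] -/
theorem mordellWeilRank_eq_four :
    haveI := isElliptic
    (kubertTateFive ((13 : ℤ) : K3) ((14 : ℤ) : K3)).mordellWeilRank = 4 := by
  have h := descent.2.2
  omega

end KubertTate1314EisensteinDescent

end Literature.NumberTheory.EllipticCurves

end
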